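import Mathlib
import Summits.KontsevichZagierPeriods.KontsevichZagierPeriods.Theorems.TorsionLogsGKZLevelThreePairBetaArctan
import Summits.KontsevichZagierPeriods.KontsevichZagierPeriods.Theorems.TorsionLogsGKZLevelThreePairNormalForm
import Summits.KontsevichZagierPeriods.KontsevichZagierPeriods.Theorems.HurwitzMicroSectorsHurwitzSectorComplementStubArcRotation
import Summits.KontsevichZagierPeriods.KontsevichZagierPeriods.Theorems.CompiledSubstitutionsPiNormalisation
import Summits.KontsevichZagierPeriods.KontsevichZagierPeriods.Theorems.BetaCancellation.Negative.Torsion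
import Summits.KontsevichZagierPeriods.KontsevichZagierPeriods.Theorems.GammaHodgeSector.Negative.Calibration
import Literature.NumberTheory.Transcendental.KZDirichletPeeling

/-!
# Route TorsionLogs — support item `GKZLevelThreePair`: Euler's reflection at `1/3`, III
# (`B(2/3,1/3) ∼ [unit disc, 2/√3]`, and the blueprint's core `r ∼ Brep × [(1,2), 6/t]`)

Helper file for item `stmt-KontsevichZagierPeriods-13812` (`GKZLevelThreePair`), finishing step
(S6) of the prover's blueprint. Files I–II (`…BetaCubic.lean`, `…BetaArctan.lean`) carried the Beta
factor `Brep = [(0,1), s^{-1/3}(1-s)^{-2/3}]` (value `Γ(2/3)Γ(1/3) = 2π/√3`) to the arctangent arc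
`[(0,√3), 2√3/(1+x²)]`. Here:

* `three_nsmul_arctanArc_sub_two_nsmul_piRep_mem` — `3 • [(0,√3), 2/(1+x²)] − 2 • [π] ∈ relations`:
  the arc-rotation ladder of `stub_arcRotation` (route HurwitzMicroSectors) at `N = 3`, `a = 1`
  (`tan(π/3) = √3`: `[(0,√3)] ≡ 2 • [(0,tan(π/6))]`, `3 • [(0,tan(π/6))] ≡ 2 • [(0,1)]`), the line
  ladder `[ℝ, dt/(1+t²)] ≡ 4 • [(0,1), dt/(1+t²)]` of `PiLine.lean`, and `[ℝ, 1/(1+x²)] ∼ [π]`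
  (`PiNormalisation`, route CompiledSubstitutions);
* `arctanArc_equivalent_disc` — `[(0,√3), 2√3/(1+x²)] ∼ [closed unit disc, 2/√3]`, by scaling the
  previous relation by the algebraic constant `√3` and cancelling the integer `3`
  (torsion-freeness of `FormalRep ⧸ relations`, `BetaCancellation/Negative/Torsion.lean`);
* `beta_equivalent_disc` — **Euler's reflection at `1/3` inside the rules**:
  `[(0,1), s^{-1/3}(1-s)^{-2/3}] ∼ [closed unit disc, 2/√3]` (`B(2/3,1/3) = (2/√3) · π`);
* (in `…BetaEulerReflection.lean`) the instances `a = 2/3` and `a = 1/3` of item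
  `EulerReflectionRational` (stmt-KontsevichZagierPeriods-3383, route CompiledSubstitutions);
* `gkzLevelThreePair_of_core'` — the reduction of `GKZLevelThreePair` to the core in the shape the
  blueprint reaches it: `r ∼ Brep × [(1,2), 6/t]` (`J₃ = B(2/3,1/3) · 6 log 2`).

## References

* M. Kontsevich, D. Zagier, *Periods* (2001), §1.1–1.2.
* G. Andrews, R. Askey, R. Roy, *Special Functions* (1999), Thm. 1.2.1 (Euler's reflection formula).
-/

-- `Summit.<Summit>.<Sub>` with Sub = Summit (single-conjunct summit, D-0017) duplicates the segment.
set_option linter.dupNamespace false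

noncomputable section

namespace Summit.KontsevichZagierPeriods.KontsevichZagierPeriods.Theorems.GKZLevelThree

open Set MeasureTheory
open MvPolynomial (aeval X C)
open Literature.NumberTheory.Transcendental Literature.NumberTheory.Transcendental.KZ
open Literature.ModelTheory.ExponentialFields (IsSemialgebraic isSemialgebraic_setOf_eval_pos)
open Summit.KontsevichZagierPeriods.Theorems.HurwitzMicroSectorsHurwitzSectorComplement (stub_arcRotation)
open Summit.KontsevichZagierPeriods.Theorems.HurwitzMicroSectorsHurwitzSectorComplement.ArcRotation
  (of_sub_two_lineRep lineRep_congr)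
open Summit.KontsevichZagierPeriods.MzvKernelInKZ.Negative
  (lineRep hq L01 sa_L01 sa_univ1 line_univ_sub_four_mem)
open Summit.KontsevichZagierPeriods.CompiledSubstitutions.PiNormalisation (piNormalisation_proof)
open Summit.KontsevichZagierPeriods.KontsevichZagierPeriods.BetaCancellationNegative
  (equivalent_of_nsmul_sub_mem)
open Summit.KontsevichZagierPeriods.GammaHodgeSectorNegative (discRep unitDisc equivalent_piRep_discRep)

/-! ## `3 • [(0,√3), 2/(1+x²)] ≡ 2 • [π]` -/

/-- The global arc representation `[ℝ, 2/(1+x²)]` exists. -/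
theorem exists_globalArcRep : ∃ G : IntegralRep 1, G.domain = univ ∧
    G.integrand = fun x => 2 / (1 + x 0 ^ 2) := by
  have hsa : IsSemialgebraicFunOn ℚ (univ : Set (Fin 1 → ℝ)) (fun x : Fin 1 → ℝ => 2 / (1 + x 0 ^ 2)) := by
    refine (isSemialgebraicFunOn_aeval_div_aeval sa_univ1 (C 2 : MvPolynomial (Fin 1) ℚ)
      (1 + X 0 ^ 2) fun x _ => ?_).congr fun x _ => ?_
    · simp only [map_add, map_one, map_pow, MvPolynomial.aeval_X]
      positivity
    · simp only [map_add, map_one, map_pow, MvPolynomial.aeval_X, MvPolynomial.aeval_C, eq_ratCast,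
        Rat.cast_ofNat]
  have hint : IntegrableOn (fun x : Fin 1 → ℝ => 2 / (1 + x 0 ^ 2)) univ := by
    have h := (Summit.KontsevichZagierPeriods.MzvKernelInKZ.Negative.integrable_hq1.const_mul 2).integrableOn
      (s := univ)
    refine h.congr_fun (fun x _ => ?_) MeasurableSet.univ
    simp only [hq]
    ring
  exact ⟨⟨univ, _, sa_univ1, hsa, hint⟩, rfl, rfl⟩

/-- **`3 • [(0,√3), 2/(1+x²)] − 2 • [π] ∈ relations`** (`[π]` the closed unit disc with integrand
`1`). The arc `(0, √3) = (0, tan(π/3))` is two grid arcs `(0, tan(π/6))` and three grid arcs are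
`2 • [(0,1), 2/(1+x²)] = 4 • [(0,1), 1/(1+x²)] = [ℝ, 1/(1+x²)] ∼ [π]`; so
`3 • arc ≡ 6 • grid ≡ 2 • [ℝ, 1/(1+x²)] ≡ 2 • [π]`. [Kontsevich–Zagier 2001, §1.1 eq. (1), §1.2] -/
theorem three_nsmul_arctanArc_sub_two_nsmul_piRep_mem (Ag : IntegralRep 1)
    (hAd : Ag.domain = {x : Fin 1 → ℝ | 0 < x 0 ∧ x 0 < Real.sqrt 3})
    (hAi : EqOn Ag.integrand (fun x => 2 / (1 + x 0 ^ 2)) Ag.domain) :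
    3 • of Ag - 2 • of piRep ∈ relations := by
  obtain ⟨G, hGd, hGi⟩ := exists_globalArcRep
  obtain ⟨ht_alg, ht_pos, hs_alg, hs_pos, H⟩ :=
    stub_arcRotation (fun v => 2 / (1 + v ^ 2)) (fun v => rfl) 3 1 one_pos (by norm_num)
  have ht3 : Real.tan (Real.pi * ((1:ℕ) : ℝ) / ((3:ℕ) : ℝ)) = Real.sqrt 3 := by
    rw [show Real.pi * ((1:ℕ) : ℝ) / ((3:ℕ) : ℝ) = Real.pi / 3 by push_cast; ring]
    exact Real.tan_pi_div_three
  set s : ℝ := Real.tan (Real.pi / (2 * ((3:ℕ) : ℝ))) with hs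
  -- the four pinned representations, as restrictions of `G`
  have hsaA : IsSemialgebraic ℚ {y : Fin 1 → ℝ | 0 < y 0 ∧ y 0 < Real.tan (Real.pi * ((1:ℕ) : ℝ) / ((3:ℕ) : ℝ))} :=
    (KZ.isSemialgebraic_setOf_const_lt_apply isAlgebraic_zero 0).inter
      (KZ.isSemialgebraic_setOf_apply_lt_const ht_alg 0)
  have hsaL : IsSemialgebraic ℚ {y : Fin 1 → ℝ | Real.tan (Real.pi * ((1:ℕ) : ℝ) / ((3:ℕ) : ℝ)) < y 0} :=
    KZ.isSemialgebraic_setOf_const_lt_apply ht_alg 0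
  have hsaα : IsSemialgebraic ℚ {y : Fin 1 → ℝ | 0 < y 0 ∧ y 0 < s} :=
    (KZ.isSemialgebraic_setOf_const_lt_apply isAlgebraic_zero 0).inter
      (KZ.isSemialgebraic_setOf_apply_lt_const hs_alg 0)
  have hsaQ : IsSemialgebraic ℚ {y : Fin 1 → ℝ | 0 < y 0 ∧ y 0 < 1} :=
    (KZ.isSemialgebraic_setOf_const_lt_apply isAlgebraic_zero 0).inter
      (KZ.isSemialgebraic_setOf_apply_lt_const isAlgebraic_one 0)
  set A' := G.restrict _ hsaA (by rw [hGd]; exact subset_univ _) with hA'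
  set L := G.restrict _ hsaL (by rw [hGd]; exact subset_univ _) with hL
  set α := G.restrict _ hsaα (by rw [hGd]; exact subset_univ _) with hα
  set Q := G.restrict _ hsaQ (by rw [hGd]; exact subset_univ _) with hQ
  have hGi' : ∀ (S : Set (Fin 1 → ℝ)) (hS : IsSemialgebraic ℚ S) (hS' : S ⊆ G.domain),
      EqOn (G.restrict S hS hS').integrand (fun y => (fun v : ℝ => 2 / (1 + v ^ 2)) (y 0))
        (G.restrict S hS hS').domain := fun S hS hS' y _ => by
    rw [IntegralRep.integrand_restrict, hGi]
  obtain ⟨h1, -, h3⟩ := H A' L α Q rfl (hGi' _ _ _) rfl (hGi' _ _ _) rfl (hGi' _ _ _) rfl (hGi' _ _ _)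
  simp only [mul_one] at h1
  -- `Ag ∼ A'` (same domain, same integrand on it)
  have h0 : of Ag - of A' ∈ relations := by
    refine of_sub_of_mem_relations_of_eqOn (by rw [hA', IntegralRep.domain_restrict, ht3, hAd])
      fun x hx => ?_
    rw [hAi hx, hA', IntegralRep.integrand_restrict, hGi]
  -- `Q ≡ 2 • [(0,1), dt/(1+t²)]`, `[ℝ, dt/(1+t²)] ≡ 4 • [(0,1), dt/(1+t²)]`, `[ℝ, dt/(1+t²)] ∼ [π]`
  have hQ2 : of Q - 2 • of (lineRep Q.domain Q.isSemialgebraic_domain) ∈ relations :=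
    of_sub_two_lineRep (fun v => 2 / (1 + v ^ 2)) (fun v => rfl) Q (hGi' _ _ _)
  have hQL : of (lineRep Q.domain Q.isSemialgebraic_domain) - of (lineRep L01 sa_L01) ∈ relations :=
    lineRep_congr _ _ rfl
  have hU : of (lineRep univ sa_univ1) - 4 • of (lineRep L01 sa_L01) ∈ relations :=
    line_univ_sub_four_mem
  have hπ : Equivalent (lineRep univ sa_univ1) piRep :=
    (piNormalisation_proof piRep rfl (fun _ _ => rfl)).1 (lineRep univ sa_univ1) rfl (fun x _ => rfl)
  have e : 3 • of Ag - 2 • of piRep =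
      3 • (of Ag - of A') + 3 • (of A' - 2 • of α) + 2 • (3 • of α - 2 • of Q) +
      4 • (of Q - 2 • of (lineRep Q.domain Q.isSemialgebraic_domain)) +
      8 • (of (lineRep Q.domain Q.isSemialgebraic_domain) - of (lineRep L01 sa_L01)) -
      2 • (of (lineRep univ sa_univ1) - 4 • of (lineRep L01 sa_L01)) +
      2 • (of (lineRep univ sa_univ1) - of piRep) := by abel
  rw [e]
  refine relations.add_mem (relations.sub_mem (relations.add_mem (relations.add_mem
    (relations.add_mem (relations.add_mem (relations.nsmul_mem h0 3) (relations.nsmul_mem h1 3))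
    (relations.nsmul_mem h3 2)) (relations.nsmul_mem hQ2 4)) (relations.nsmul_mem hQL 8))
    (relations.nsmul_mem hU 2)) (relations.nsmul_mem hπ 2)

/-! ## `[(0,√3), 2√3/(1+x²)] ∼ [unit disc, 2/√3]` -/

/-- `√3 ≠ 0`. -/
theorem sqrt_three_ne_zero : Real.sqrt 3 ≠ 0 := (Real.sqrt_pos.2 (by norm_num)).ne'

/-- `2/√3` is algebraic over `ℚ`. -/
theorem isAlgebraic_two_div_sqrt_three : IsAlgebraic ℚ (2 / Real.sqrt 3) := by
  have h2 : IsAlgebraic ℚ (2:ℝ) := by simpa using isAlgebraic_nat (R := ℚ) (A := ℝ) 2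
  rw [div_eq_mul_inv]
  exact h2.mul isAlgebraic_sqrt_three.inv

/-- **`[(0,√3), 2√3/(1+x²)] ∼ [closed unit disc, 2/√3]`**: scale
`3 • [(0,√3), 2/(1+x²)] ≡ 2 • [π]` by the algebraic constant `√3` (the scaling endomorphism
preserves relations), rewrite `3 • [disc, 2/√3] ≡ [disc, 2√3] ≡ 2 • [disc, √3]` (integer multiples
are integrand additivity), and cancel the integer `3` (torsion-freeness of `FormalRep ⧸ relations`).
[Kontsevich–Zagier 2001, §1.2] -/
theorem arctanArc_equivalent_disc (A : IntegralRep 1) (P : IntegralRep 2)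
    (hAd : A.domain = {x : Fin 1 → ℝ | 0 < x 0 ∧ x 0 < Real.sqrt 3})
    (hAi : EqOn A.integrand (fun x => 2 * Real.sqrt 3 / (1 + x 0 ^ 2)) A.domain)
    (hPd : P.domain = {z | z 0 ^ 2 + z 1 ^ 2 ≤ 1})
    (hPi : EqOn P.integrand (fun _ => 2 / Real.sqrt 3) P.domain) :
    Equivalent A P := by
  have h3pos : 0 < Real.sqrt 3 := Real.sqrt_pos.2 (by norm_num)
  have h3sq : Real.sqrt 3 ^ 2 = 3 := Real.sq_sqrt (by norm_num)
  -- the rational arc `Ag = [(0,√3), 2/(1+x²)]`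
  obtain ⟨Ag, hAgd, hAgi⟩ : ∃ r : IntegralRep 1, r.domain = {x : Fin 1 → ℝ | 0 < x 0 ∧ x 0 < Real.sqrt 3} ∧
      r.integrand = fun x => 2 / (1 + x 0 ^ 2) := by
    refine exists_rep_Ioo₁ isAlgebraic_zero isAlgebraic_sqrt_three (fun v => 2 / (1 + v ^ 2))
      (continuousOn_const.div (by fun_prop) fun v _ => by positivity) ?_
    refine isSemialgebraicFunOn_ratFun₁ ((KZ.isSemialgebraic_setOf_const_lt_apply isAlgebraic_zero 0).inter
      (KZ.isSemialgebraic_setOf_apply_lt_const isAlgebraic_sqrt_three 0)) (C 2) (1 + X 0 ^ 2)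
      (fun v => 2 / (1 + v ^ 2)) (fun x _ => ?_) (fun x _ => ?_)
    · simp only [map_add, map_one, map_pow, MvPolynomial.aeval_X]
      positivity
    · simp
  have hrel := three_nsmul_arctanArc_sub_two_nsmul_piRep_mem Ag hAgd (fun x _ => by rw [hAgi])
  -- scale by `√3`
  have hscale := scale_mem_relations (Real.sqrt 3) isAlgebraic_sqrt_three hrel
  rw [map_sub, map_nsmul, map_nsmul, scale_of, scale_of] at hscale
  -- `A ∼ √3 · Ag`
  have hA : of A - of (Ag.constMul (Real.sqrt 3) isAlgebraic_sqrt_three) ∈ relations := by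
    refine of_sub_of_mem_relations_of_eqOn (by rw [IntegralRep.domain_constMul, hAgd, hAd])
      fun x hx => ?_
    rw [hAi hx, IntegralRep.integrand_constMul, hAgi]
    ring
  -- `3 • [P] ≡ 2 • [√3 · π]`
  have hP : of P - of (piRep.constMul (2 / Real.sqrt 3) isAlgebraic_two_div_sqrt_three) ∈ relations := by
    refine of_sub_of_mem_relations_of_eqOn (by rw [IntegralRep.domain_constMul, hPd]; rfl)
      fun z hz => ?_
    rw [hPi hz, IntegralRep.integrand_constMul, piRep_integrand]
    ring
  have hP3 : of ((piRep.constMul (2 / Real.sqrt 3) isAlgebraic_two_div_sqrt_three).constMul ((3:ℕ) : ℝ)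
      (isAlgebraic_nat 3)) - 3 • of (piRep.constMul (2 / Real.sqrt 3) isAlgebraic_two_div_sqrt_three)
      ∈ relations :=
    (piRep.constMul (2 / Real.sqrt 3) isAlgebraic_two_div_sqrt_three).of_constMul_nat_sub_nsmul_mem_relations 3
  have hP2 : of ((piRep.constMul (Real.sqrt 3) isAlgebraic_sqrt_three).constMul ((2:ℕ) : ℝ)
      (isAlgebraic_nat 2)) - 2 • of (piRep.constMul (Real.sqrt 3) isAlgebraic_sqrt_three) ∈ relations :=
    (piRep.constMul (Real.sqrt 3) isAlgebraic_sqrt_three).of_constMul_nat_sub_nsmul_mem_relations 2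
  have hPP : of ((piRep.constMul (2 / Real.sqrt 3) isAlgebraic_two_div_sqrt_three).constMul ((3:ℕ) : ℝ)
      (isAlgebraic_nat 3)) - of ((piRep.constMul (Real.sqrt 3) isAlgebraic_sqrt_three).constMul
      ((2:ℕ) : ℝ) (isAlgebraic_nat 2)) ∈ relations := by
    refine of_sub_of_mem_relations_of_eqOn rfl fun z _ => ?_
    simp only [IntegralRep.integrand_constMul, piRep_integrand, Nat.cast_ofNat, mul_one]
    field_simp
    nlinarith [h3sq]
  -- assemble `3 • ([A] − [P]) ∈ relations`
  refine equivalent_of_nsmul_sub_mem (k := 3) (by norm_num) ?_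
  have e : 3 • (of A - of P) =
      3 • (of A - of (Ag.constMul (Real.sqrt 3) isAlgebraic_sqrt_three)) +
      (3 • of (Ag.constMul (Real.sqrt 3) isAlgebraic_sqrt_three) -
        2 • of (piRep.constMul (Real.sqrt 3) isAlgebraic_sqrt_three)) -
      3 • (of P - of (piRep.constMul (2 / Real.sqrt 3) isAlgebraic_two_div_sqrt_three)) +
      (of ((piRep.constMul (2 / Real.sqrt 3) isAlgebraic_two_div_sqrt_three).constMul ((3:ℕ) : ℝ)
        (isAlgebraic_nat 3)) - 3 • of (piRep.constMul (2 / Real.sqrt 3) isAlgebraic_two_div_sqrt_three)) -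
      (of ((piRep.constMul (2 / Real.sqrt 3) isAlgebraic_two_div_sqrt_three).constMul ((3:ℕ) : ℝ)
        (isAlgebraic_nat 3)) - of ((piRep.constMul (Real.sqrt 3) isAlgebraic_sqrt_three).constMul
        ((2:ℕ) : ℝ) (isAlgebraic_nat 2))) -
      (of ((piRep.constMul (Real.sqrt 3) isAlgebraic_sqrt_three).constMul ((2:ℕ) : ℝ)
        (isAlgebraic_nat 2)) - 2 • of (piRep.constMul (Real.sqrt 3) isAlgebraic_sqrt_three)) := by
    abel
  rw [e]
  exact relations.sub_mem (relations.sub_mem (relations.add_mem (relations.sub_mem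
    (relations.add_mem (relations.nsmul_mem hA 3) hscale) (relations.nsmul_mem hP 3)) hP3) hPP) hP2

/-- **Euler's reflection at `1/3`, inside the rules.** Every Beta representation
`[(0,1), s^{-1/3}(1-s)^{-2/3}]` (value `B(2/3,1/3) = Γ(2/3)Γ(1/3)`) is KZ-equivalent to every disc
representation `[closed unit disc, 2/√3]` (value `2π/√3`): Files I–II and
`arctanArc_equivalent_disc`. This is the reflection formula `Γ(1/3)Γ(2/3) = 2π/√3` realised by
moves. [Andrews–Askey–Roy 1999, Thm. 1.2.1; Kontsevich–Zagier 2001, §1.2] -/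
theorem beta_equivalent_disc (β : IntegralRep 1) (P : IntegralRep 2)
    (hβd : β.domain = {x | x 0 ∈ Set.Ioo (0:ℝ) 1})
    (hβi : EqOn β.integrand (fun x => (x 0) ^ (-(1:ℝ) / 3) * (1 - x 0) ^ (-(2:ℝ) / 3)) β.domain)
    (hPd : P.domain = {z | z 0 ^ 2 + z 1 ^ 2 ≤ 1})
    (hPi : EqOn P.integrand (fun _ => 2 / Real.sqrt 3) P.domain) :
    Equivalent β P := by
  obtain ⟨A, hAd, hAi⟩ : ∃ r : IntegralRep 1, r.domain = {x : Fin 1 → ℝ | 0 < x 0 ∧ x 0 < Real.sqrt 3} ∧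
      r.integrand = fun x => 2 * Real.sqrt 3 / (1 + x 0 ^ 2) := by
    refine exists_rep_Ioo₁ isAlgebraic_zero isAlgebraic_sqrt_three (fun v => 2 * Real.sqrt 3 / (1 + v ^ 2))
      (continuousOn_const.div (by fun_prop) fun v _ => by positivity) ?_
    have hs : IsSemialgebraic ℚ {x : Fin 1 → ℝ | 0 < x 0 ∧ x 0 < Real.sqrt 3} :=
      (KZ.isSemialgebraic_setOf_const_lt_apply isAlgebraic_zero 0).inter
        (KZ.isSemialgebraic_setOf_apply_lt_const isAlgebraic_sqrt_three 0)
    have h1 : IsSemialgebraicFunOn ℚ {x : Fin 1 → ℝ | 0 < x 0 ∧ x 0 < Real.sqrt 3}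
        (fun x => (fun v : ℝ => 2 / (1 + v ^ 2)) (x 0)) := by
      refine isSemialgebraicFunOn_ratFun₁ hs (C 2) (1 + X 0 ^ 2) (fun v => 2 / (1 + v ^ 2))
        (fun x _ => ?_) (fun x _ => ?_)
      · simp only [map_add, map_one, map_pow, MvPolynomial.aeval_X]
        positivity
      · simp
    have h2 : IsSemialgebraicFunOn ℚ {x : Fin 1 → ℝ | 0 < x 0 ∧ x 0 < Real.sqrt 3}
        (fun _ => Real.sqrt 3) := isSemialgebraicFunOn_const_of_isAlgebraic hs isAlgebraic_sqrt_three
    exact (IsSemialgebraicFunOn.mul_holds h2 h1).congr fun x _ => by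
      simp only [Pi.mul_apply]; ring
  exact (beta_equivalent_arctanArc β A hβd hβi hAd (fun x _ => by rw [hAi])).trans
    (arctanArc_equivalent_disc A P hAd (fun x _ => by rw [hAi]) hPd hPi)

/-! ## The core of `GKZLevelThreePair` in the blueprint's shape `r ∼ Brep × [(1,2), 6/t]` -/

/-- `√3 · √48 = 12`. -/
theorem sqrt_three_mul_sqrt48 : Real.sqrt 3 * Real.sqrt 48 = 12 := by
  rw [← Real.sqrt_mul (by norm_num), show (3:ℝ) * 48 = 12 ^ 2 by norm_num,
    Real.sqrt_sq (by norm_num)]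

/-- **Reduction of `GKZLevelThreePair` to the blueprint's core.** If every Euler representation `r`
of the item is KZ-equivalent to the product of a Beta representation
`β = [(0,1), s^{-1/3}(1-s)^{-2/3}]` (value `B(2/3,1/3)`) and an interval representation
`L₆ = [(1,2), 6/t]` (value `6 log 2`) — the shape `J₃ = B(2/3,1/3) · T`, `T = 6 log 2`, reached by
the blueprint's steps (S1)–(S5) — then `GKZLevelThreePair` holds: `β ∼ [disc, 2/√3]`
(`beta_equivalent_disc`, closed disc `∼` open disc), so `β × L₆ ∼ [open disc, 2/√3] × L₆`, which
has the same domain and integrand (`(2/√3) · 6 = √48`) as the normal form `D × L` of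
`gkzLevelThreePair_of_core`. [Kontsevich–Zagier 2001, §1.2, §4.1; Zhou 2015, Remark 9] -/
theorem gkzLevelThreePair_of_core'
    (hcore : ∀ (r : IntegralRep 3), r.domain = {x | ∀ i, x i ∈ Set.Ioo (0:ℝ) 1} →
      EqOn r.integrand (fun x => (x 0) ^ (-(1:ℝ) / 3) * (1 - x 0) ^ (-(2:ℝ) / 3) *
        (1 - (1 - x 2) * x 0 / 2) ^ (-(1:ℝ) / 3) * ((x 1) ^ (-(1:ℝ) / 3) * (1 - x 1) ^ (-(2:ℝ) / 3) *
        (1 - (1 - x 2) * x 1 / 2) ^ (-(1:ℝ) / 3))) r.domain →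
      ∀ (β L₆ : IntegralRep 1), β.domain = {x | x 0 ∈ Set.Ioo (0:ℝ) 1} →
        EqOn β.integrand (fun x => (x 0) ^ (-(1:ℝ) / 3) * (1 - x 0) ^ (-(2:ℝ) / 3)) β.domain →
        L₆.domain = {t | t 0 ∈ Set.Ioo (1:ℝ) 2} → EqOn L₆.integrand (fun t => 6 / t 0) L₆.domain →
        Equivalent r (β.prod L₆)) :
    Summit.KontsevichZagierPeriods.KontsevichZagierPeriods.Theses.TorsionLogs.GKZLevelThreePair := by
  have h3pos : 0 < Real.sqrt 3 := Real.sqrt_pos.2 (by norm_num)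
  have hc : IsAlgebraic ℚ (Real.sqrt 3 / 2) := by
    have h2 : IsAlgebraic ℚ (2:ℝ) := by simpa using isAlgebraic_nat (R := ℚ) (A := ℝ) 2
    rw [div_eq_mul_inv]
    exact isAlgebraic_sqrt_three.mul h2.inv
  refine gkzLevelThreePair_of_core fun r hrd hri D L hDd hDi hLd hLi => ?_
  -- the Beta factor and `L₆ = (√3/2) · L`
  obtain ⟨β, hβd, hβi⟩ := exists_betaRep' (2 / 3) (1 / 3) (by norm_num) (by norm_num)
  have hβi' : EqOn β.integrand (fun x => (x 0) ^ (-(1:ℝ) / 3) * (1 - x 0) ^ (-(2:ℝ) / 3)) β.domain := by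
    intro x _
    rw [hβi]
    norm_num
  set L₆ := L.constMul (Real.sqrt 3 / 2) hc with hL₆
  have hL₆i : EqOn L₆.integrand (fun t => 6 / t 0) L₆.domain := by
    intro t ht
    have ht' : t ∈ L.domain := by simpa [hL₆] using ht
    simp only [hL₆, IntegralRep.integrand_constMul, hLi ht']
    rw [div_mul_div_comm, sqrt_three_mul_sqrt48]
    ring
  have h1 : Equivalent r (β.prod L₆) := hcore r hrd hri β L₆ hβd hβi' (by rw [hL₆]; simpa using hLd) hL₆i
  -- `β ∼ [closed disc, 2/√3] ∼ [open disc, 2/√3] ∼ (2/√3) · D`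
  have h2 : Equivalent β (piRep.constMul (2 / Real.sqrt 3) isAlgebraic_two_div_sqrt_three) :=
    beta_equivalent_disc β _ hβd hβi' rfl fun z _ => by
      rw [IntegralRep.integrand_constMul, piRep_integrand]; ring
  have h3 : Equivalent (piRep.constMul (2 / Real.sqrt 3) isAlgebraic_two_div_sqrt_three)
      (D.constMul (2 / Real.sqrt 3) isAlgebraic_two_div_sqrt_three) := by
    refine (equivalent_piRep_discRep.constMul _ _).trans
      (of_sub_of_mem_relations_of_eqOn ?_ fun z hz => ?_)
    · rw [IntegralRep.domain_constMul, IntegralRep.domain_constMul, hDd]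
      ext z
      simp [discRep, unitDisc, Fin.sum_univ_two]
    · have hz' : z ∈ D.domain := by
        rw [hDd]
        have : z ∈ unitDisc := hz
        simpa [unitDisc, Fin.sum_univ_two] using this
      simp only [IntegralRep.integrand_constMul]
      rw [hDi hz']
      simp [discRep]
  -- `(2/√3) · D × L₆` and `D × L` have the same domain and integrand
  have h4 : Equivalent ((D.constMul (2 / Real.sqrt 3) isAlgebraic_two_div_sqrt_three).prod L₆) (D.prod L) := by
    refine of_sub_of_mem_relations_of_eqOn rfl fun z hz => ?_
    have hzL : (fun j : Fin 1 => z (Fin.natAdd 2 j)) ∈ L.domain := hz.2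
    rw [IntegralRep.prod_integrand_eq, IntegralRep.prod_integrand_eq, IntegralRep.prodFun_apply,
      IntegralRep.prodFun_apply, IntegralRep.integrand_constMul]
    show 2 / Real.sqrt 3 * D.integrand _ * L₆.integrand _ = D.integrand _ * L.integrand _
    have h12 : 2 / Real.sqrt 3 * (Real.sqrt 3 / 2) = 1 := by
      rw [div_mul_div_comm, mul_comm (2:ℝ) (Real.sqrt 3),
        div_self (mul_ne_zero sqrt_three_ne_zero two_ne_zero)]
    have key : ∀ d q : ℝ, 2 / Real.sqrt 3 * d * (Real.sqrt 3 / 2 * q) = d * q := fun d q => by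
      calc 2 / Real.sqrt 3 * d * (Real.sqrt 3 / 2 * q)
          = (2 / Real.sqrt 3 * (Real.sqrt 3 / 2)) * (d * q) := by ring
        _ = d * q := by rw [h12, one_mul]
    simp only [hL₆, IntegralRep.integrand_constMul, hLi hzL]
    exact key _ _
  exact ((h1.trans (Equivalent.prod (h2.trans h3) (Equivalent.refl L₆))).trans h4)

end Summit.KontsevichZagierPeriods.KontsevichZagierPeriods.Theorems.GKZLevelThree

end
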